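import Literature.Computability.AlgebraicComplexity.Yab15BRankProofs
import Literature.Computability.AlgebraicComplexity.SymmetricDetRepresentationProofs
import HarnessLib

/-!
# Yabe 2015, Prop. 2.7: `brank((p_{x₀})^{(2k)}) ≤ dc(p)²` at a non-zero `x₀` — proof of the named fact
# `yabe2015_prop_2_7`, via the width-`n²` Mahajan–Vinay branching program (Yabe Thm. 2.11, Fact 2.10)

Topic `Literature/Computability/AlgebraicComplexity`; proofs companion of `Yab15BRank.lean` (A. Yabe,
*Bi-polynomial rank and determinantal complexity*, arXiv:1504.00151 [Yabe2015], held text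
`paper:arxiv-1504.00151`), **Proposition 2.7** (§2.3, p0006:L62): "For a polynomial `p ∈ K[x]`,
`k ∈ ℕ`, and `x₀ ∈ K^D ∖ Zeros(p)`, it holds that `dc(p) ≥ √(brank(p_{x₀}^{(2k)}))`", typed (squared,
`k ≥ 1`) as `Literature.Computability.AlgebraicComplexity.yabe2015_prop_2_7`. Cell val-lit (D-0074),
discharge by typer t15 g2 (registry claim); no new definitions of notions, no named facts (D-0026).

## The printed proof (p0006:L72–p0007:L12) and how it is followed

* **Lemma 2.8** (p0006:L74–L91): `p_{x₀}(x) = α det(A(x) + I)` with `A` a LINEAR polynomial matrix of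
  size `n = dc(p)` — in tree, `yabe2015_lemma_2_8_holds` (`Yab15BRankProofs.lean`, cell val-lit p7); used
  as is.
* "Then `p_{x₀}^{(2k)}` is equal to the coefficient of `λ^{n−2k}` in `α det(A(x) + λI)`" (p0007:L7): here
  `homogeneousComponent_det_one_add_mvPolynomialX` — for the GENERIC matrix `X = (X_{ij})`, the degree-`d`
  part of `det(1 + X)` is `(−1)^d · e n d`, where `GKKP2011.e n d = [t^{n−d}] χ_X(t)` is the tree's graded
  characteristic coefficient (`SymmetricDetRepresentationProofs.lean`, Part B) — transported to `A` by the
  substitution `X_{ij} ↦ A_{ij}` (`Matrix.charpoly_map` in the guise of `RingHom.map_det`;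
  `homogeneousComponent_aeval_of_isHomogeneous_one`: substituting linear forms commutes with taking
  homogeneous components).
* **Thm. 2.11** (Mahajan–Vinay [MV97], p0006:L135: the coefficient of `λ^{n−r}` in `det(A(x) + λI)` has
  an ABP with `w_k ≤ n²` for all `k ∈ [1, r−1]`) and **Fact 2.10** (p0006:L113–L131: `brank(f) ≤ w_k(f)`,
  split every source–sink path at layer `k`: `f = Σ_{v ∈ V_k} (Σ_{γ ∈ R_v} f_γ)(Σ_{γ' ∈ R'_v} f_γ')`): the
  tree's Mahajan–Vinay program is the signed clow dynamics `GKKP2011.sv` / transfer matrix `GKKP2011.T₀`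
  on the `n²` states `(t, u) ∈ Fin n × Fin n` (Berkowitz orientation), with
  `e n d = Σ_t sv d t t` (`e_self_eq_sum_sv`, from `GKKP2011.sv_spec`) and
  `sv (d+1) = start₀ · T₀^d` (`GKKP2011.start₀_vecMul_pow`); splitting `T₀^{2k−1} = T₀^{k−1} · T₀^k`
  gives `e n (2k) = Σ_{σ ∈ Fin n × Fin n} pre_k(σ) · suf_k(σ)` (`e_self_two_mul_succ_eq_sum`) with
  `pre`, `suf` sums of products of `k` edge labels, hence homogeneous of degree `k`
  (`isHomogeneous_sv`, `isHomogeneous_T₀_pow`) — `n²` products, i.e. width `n²` at layer `k`.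
* Conclusion (p0007:L11–L12): `brank(p_{x₀}^{(2k)}) ≤ w_k ≤ n² = dc(p)²` — `bRank_le_of_eq_sum` of
  `Yab15BRank.lean` (`bRank_homogeneousComponent_det_add_one_le_sq`, then `yabe2015_prop_2_7_holds`).

Deviations: none in substance; the ABP is not materialised as a graph but as the matrix product
`start₀ · T₀^{k−1} · (T₀^k · 1_diag)` (exactly Fact 2.10's bilinear split), and the case `2k > n`
(component `0`) needs no separate treatment (`e n d = 0` for `d > n`). Honest framing: a published
upper bound on the bi-polynomial rank at NON-zeros (the "weaker statement" of Yabe §2.3); the lower-bound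
programme (Thm. 1.5 at zeros) is elsewhere; nothing here bears on VP versus VNP.

## References

* [Yabe2015] A. Yabe, *Bi-polynomial rank and determinantal complexity*, arXiv:1504.00151 (2015), §2.3:
  Prop. 2.7, Lemma 2.8, Def. 2.9, Fact 2.10, Thm. 2.11 (p0006–p0007).
* [MahajanVinay1997] M. Mahajan, V. Vinay, *Determinant: combinatorics, algorithms, and complexity*,
  Chicago J. Theoret. Comput. Sci. 1997, Art. 5 (the width-`n²` program for the coefficients of the
  characteristic polynomial).
-/

noncomputable section

open MvPolynomial Matrix Finset

namespace Literature.Computability.AlgebraicComplexity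

universe u v

namespace YabeABP

open Berkowitz GKKP2011

variable {K : Type u} [CommRing K] {n : ℕ}

/-! ### The Mahajan–Vinay dynamics is graded: `sv d`, `T₀^d` are homogeneous of degree `d` -/

/-- The generic entries `xvar a b` (`X_{ab}` or `0`) are linear forms. [folklore] -/
private theorem isHomogeneous_xvar (a b : ℕ) : (xvar K n a b).IsHomogeneous 1 := by
  unfold xvar
  split_ifs
  · exact isHomogeneous_X K _
  · exact isHomogeneous_zero _ K 1

/-- The signed edge weights `stepW` (`X`, `−X` or `0`) are linear forms. [folklore] -/
private theorem isHomogeneous_stepW (f t u : ℕ) : (stepW K n f t u).IsHomogeneous 1 := by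
  unfold stepW
  split_ifs
  · exact isHomogeneous_xvar f u
  · exact (isHomogeneous_xvar f t).neg
  · exact isHomogeneous_zero _ K 1

/-- **Yabe Def. 2.9 (homogeneous ABP): the layer-`d` values are forms of degree `d`.** The signed clow
dynamics `sv d t u` (the value of the state `(t, u)` after `d` edges of the Mahajan–Vinay program) is
homogeneous of degree `d` in the matrix entries. [cite: Yabe2015, Definition 2.9] -/
theorem isHomogeneous_sv : ∀ (d t u : ℕ), (sv K n d t u).IsHomogeneous d
  | 0, t, u => by
    show (0 : MvPolynomial (Fin n × Fin n) K).IsHomogeneous 0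
    exact isHomogeneous_zero _ K 0
  | d + 1, t, u => by
    rw [sv_succ, stepOp]
    have hb : (bmass K n (sv K n d) d t).IsHomogeneous d := by
      unfold bmass
      refine IsHomogeneous.add ?_ (IsHomogeneous.sum _ _ _ fun t' _ => isHomogeneous_sv d t' t')
      split_ifs with h
      · subst h; exact isHomogeneous_one _ K
      · exact isHomogeneous_zero _ K d
    exact IsHomogeneous.add
      (IsHomogeneous.sum _ _ _ fun w _ => (isHomogeneous_sv d t w).mul (isHomogeneous_stepW w t u))
      (hb.mul (isHomogeneous_stepW t t u))

/-- The entries of the transfer matrix `T₀` are linear forms. [cite: Yabe2015, Definition 2.9] -/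
private theorem isHomogeneous_T₀ (σ σ' : Fin n × Fin n) : (T₀ K n σ σ').IsHomogeneous 1 := by
  simp only [T₀, Matrix.of_apply]
  split_ifs
  · exact isHomogeneous_stepW _ _ _
  · exact isHomogeneous_zero _ K 1
  · exact isHomogeneous_stepW _ _ _
  · exact isHomogeneous_zero _ K 1
  · exact isHomogeneous_zero _ K 1

/-- The entries of `T₀^j` (sums over `j`-edge walks of the program) are forms of degree `j`.
[cite: Yabe2015, Definition 2.9] -/
theorem isHomogeneous_T₀_pow : ∀ (j : ℕ) (σ σ' : Fin n × Fin n), ((T₀ K n ^ j) σ σ').IsHomogeneous j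
  | 0, σ, σ' => by
    rw [pow_zero, Matrix.one_apply]
    split_ifs
    · exact isHomogeneous_one _ K
    · exact isHomogeneous_zero _ K 0
  | j + 1, σ, σ' => by
    rw [pow_succ, Matrix.mul_apply]
    exact IsHomogeneous.sum _ _ _ fun τ _ => (isHomogeneous_T₀_pow j σ τ).mul (isHomogeneous_T₀ τ σ')

/-! ### The graded characteristic coefficients through the dynamics -/

/-- `e n d = Σ_{t<n} sv d t t` for `d ≥ 1`: the degree-`d` characteristic coefficient of the generic
`n × n` matrix is the total value of the closed heads after `d` edges (telescoping `GKKP2011.sv_spec`;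
the case `d = n` is `GKKP2011.sum_sv_diag`). [cite: Yabe2015, Theorem 2.11] -/
theorem e_self_eq_sum_sv {d : ℕ} (hd : 1 ≤ d) : e K n n d = ∑ t ∈ range n, sv K n d t t := by
  simp_rw [(sv_spec (k := K) (n := n) d).2.1]
  rw [Finset.sum_range_sub (fun t' => e K n t' d), e_zero_left, if_neg (by omega), sub_zero]

/-- The characteristic coefficients `e n d` of the generic matrix are forms of degree `d`.
[cite: Yabe2015, Theorem 2.11] -/
theorem isHomogeneous_e_self (d : ℕ) : (e K n n d).IsHomogeneous d := by
  rcases Nat.eq_zero_or_pos d with rfl | hd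
  · rw [e_zero_right]; exact isHomogeneous_one _ K
  · rw [e_self_eq_sum_sv hd]
    exact IsHomogeneous.sum _ _ _ fun t _ => isHomogeneous_sv d t t

/-- The suffix sums of Fact 2.10 — from the state `σ`, `k + 1` more edges ending in a closed head,
`Σ_t (T₀^{k+1})_{σ,(t,t)}` — are forms of degree `k + 1`. [cite: Yabe2015, Fact 2.10] -/
theorem isHomogeneous_sum_T₀_pow_diag (k : ℕ) (σ : Fin n × Fin n) :
    (∑ t : Fin n, (T₀ K n ^ (k + 1)) σ (t, t)).IsHomogeneous (k + 1) :=
  IsHomogeneous.sum _ _ _ fun _ _ => isHomogeneous_T₀_pow _ _ _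

/-- **Yabe Thm. 2.11 + Fact 2.10 for the generic matrix (width `n²` at the middle layer):**
`e n (2(k+1)) = Σ_{σ ∈ Fin n × Fin n} pre_k(σ) · suf_k(σ)` — the coefficient of `λ^{n−2(k+1)}` of the
characteristic polynomial of `(X_{ij})` is a sum of `n²` products of two forms of degree `k + 1`
(split `start₀ · T₀^{2k+1} = (start₀ · T₀^k) · T₀^{k+1}` at layer `k + 1`).
[cite: Yabe2015, Theorem 2.11; Fact 2.10] -/
theorem e_self_two_mul_succ_eq_sum (k : ℕ) :
    e K n n (2 * (k + 1)) = ∑ σ : Fin n × Fin n,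
      sv K n (k + 1) σ.1 σ.2 * ∑ t : Fin n, (T₀ K n ^ (k + 1)) σ (t, t) := by
  rw [e_self_eq_sum_sv (by omega), ← Fin.sum_univ_eq_sum_range (fun t => sv K n (2 * (k + 1)) t t) n]
  have h1 : ∀ t : Fin n, sv K n (2 * (k + 1)) t t =
      ((fun σ : Fin n × Fin n => sv K n (k + 1) σ.1 σ.2) ᵥ* T₀ K n ^ (k + 1)) (t, t) := by
    intro t
    have h := congrFun (start₀_vecMul_pow (k := K) (n := n) (2 * k + 1)) (t, t)
    rw [show 2 * k + 1 + 1 = 2 * (k + 1) by omega] at h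
    rw [← h, show 2 * k + 1 = k + (k + 1) by omega, pow_add, ← Matrix.vecMul_vecMul,
      start₀_vecMul_pow]
  simp_rw [h1]
  simp only [Matrix.vecMul, dotProduct, Finset.mul_sum]
  exact Finset.sum_comm

/-! ### The degree-`d` part of `det(1 + X)` is the characteristic coefficient `(−1)^d e n d` -/

/-- For the generic matrix `X = (X_{ij})`: `homogeneousComponent d (det (1 + X)) = (−1)^d · e n d`, i.e.
the sum of the principal `d × d` minors ("`p_{x₀}^{(2k)}` is the coefficient of `λ^{n−2k}` in
`α det(A(x) + λI)`", p0007:L7, generic form; via `det(1 + X) = (−1)^n χ_X(−1)` and the grading of the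
`e n d`). [cite: Yabe2015, Proposition 2.7 (proof)] -/
theorem homogeneousComponent_det_one_add_mvPolynomialX (d : ℕ) :
    homogeneousComponent d (1 + mvPolynomialX (Fin n) (Fin n) K).det =
      (-1) ^ d * e K n n d := by
  nontriviality MvPolynomial (Fin n × Fin n) K
  set Xm := mvPolynomialX (Fin n) (Fin n) K with hXm
  -- `det (1 + X) = (-1)^n · χ_X(-1)`
  have hscal : Matrix.scalar (Fin n) (-1 : MvPolynomial (Fin n × Fin n) K) - Xm = -(1 + Xm) := by
    ext i j
    rw [Matrix.sub_apply, Matrix.scalar_apply, Matrix.neg_apply, Matrix.add_apply, diagonal_apply,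
      Matrix.one_apply]
    by_cases hij : i = j
    · rw [if_pos hij, if_pos hij, neg_add']
    · rw [if_neg hij, if_neg hij, zero_add, zero_sub]
  have hchi : chi K n n = Xm.charpoly := by rw [chi, genBlock_self]
  have heval : (chi K n n).eval (-1) = (-1) ^ n * (1 + Xm).det := by
    rw [hchi, Matrix.eval_charpoly, hscal, Matrix.det_neg, Fintype.card_fin]
  have hdet : (1 + Xm).det = (-1) ^ n * (chi K n n).eval (-1) := by
    rw [heval, ← mul_assoc, ← pow_add, ← two_mul, pow_mul, neg_one_sq, one_pow, one_mul]
  -- expand `χ(-1)` over its coefficients `e n (n - j)`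
  have hdeg : (chi K n n).natDegree < n + 1 := by
    rw [hchi, Matrix.charpoly_natDegree_eq_dim, Fintype.card_fin]; exact Nat.lt_succ_self n
  have hsum : (chi K n n).eval (-1) = ∑ j ∈ range (n + 1), C ((-1 : K) ^ j) * e K n n (n - j) := by
    rw [Polynomial.eval_eq_sum_range' hdeg]
    refine Finset.sum_congr rfl fun j hj => ?_
    have hj' : j ≤ n := Nat.lt_succ_iff.1 (mem_range.1 hj)
    unfold e
    rw [if_pos (Nat.sub_le n j), Nat.sub_sub_self hj', C_pow, C_neg, C_1, mul_comm]
  rw [hdet, hsum, show ((-1 : MvPolynomial (Fin n × Fin n) K)) ^ n = C ((-1 : K) ^ n) by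
    rw [C_pow, C_neg, C_1], homogeneousComponent_C_mul, map_sum]
  have hterm : ∀ j ∈ range (n + 1), homogeneousComponent d (C ((-1 : K) ^ j) * e K n n (n - j)) =
      if d = n - j then C ((-1 : K) ^ j) * e K n n (n - j) else 0 := by
    intro j _
    rw [homogeneousComponent_C_mul, homogeneousComponent_of_mem (isHomogeneous_e_self (n - j))]
    split_ifs <;> simp
  rw [Finset.sum_congr rfl hterm]
  by_cases hd : d ≤ n
  · -- only `j = n - d` survives
    have hone : ∀ j ∈ range (n + 1), (if d = n - j then C ((-1 : K) ^ j) * e K n n (n - j) else 0) =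
        if j = n - d then C ((-1 : K) ^ (n - d)) * e K n n d else 0 := by
      intro j hj
      have hj' : j ≤ n := Nat.lt_succ_iff.1 (mem_range.1 hj)
      by_cases h : j = n - d
      · subst h; rw [if_pos (Nat.sub_sub_self hd).symm, if_pos rfl, Nat.sub_sub_self hd]
      · rw [if_neg (by omega), if_neg h]
    rw [Finset.sum_congr rfl hone, Finset.sum_ite_eq', if_pos (mem_range.2 (by omega)), ← mul_assoc,
      ← C_mul, ← pow_add]
    congr 1
    rw [C_pow, C_neg, C_1]
    -- `(-1)^(n + (n - d)) = (-1)^d`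
    rw [show n + (n - d) = 2 * (n - d) + d by omega, pow_add, pow_mul, neg_one_sq, one_pow, one_mul]
  · -- `d > n`: everything vanishes
    rw [not_le] at hd
    have hzero : ∑ j ∈ range (n + 1),
        (if d = n - j then C ((-1 : K) ^ j) * e K n n (n - j) else 0) = 0 := by
      refine Finset.sum_eq_zero fun j hj => if_neg ?_
      have hj' : j ≤ n := Nat.lt_succ_iff.1 (mem_range.1 hj)
      omega
    rw [e_of_lt hd, mul_zero, hzero, mul_zero]

/-! ### Substituting linear forms -/

/-- Substituting forms of degree `1` for the variables commutes with taking homogeneous components.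
[folklore] -/
private theorem homogeneousComponent_aeval_of_isHomogeneous_one {σ τ : Type*}
    (g : τ → MvPolynomial σ K) (hg : ∀ i, (g i).IsHomogeneous 1) (q : MvPolynomial τ K) (d : ℕ) :
    homogeneousComponent d (aeval g q) = aeval g (homogeneousComponent d q) := by
  conv_lhs => rw [← sum_homogeneousComponent q]
  rw [map_sum, map_sum]
  have h : ∀ i ∈ range (q.totalDegree + 1), homogeneousComponent d (aeval g (homogeneousComponent i q)) =
      if d = i then aeval g (homogeneousComponent i q) else 0 := by
    intro i _
    have hi : (aeval g (homogeneousComponent i q)).IsHomogeneous i := by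
      simpa [one_mul] using (homogeneousComponent_isHomogeneous i q).aeval g hg
    exact homogeneousComponent_of_mem hi
  rw [Finset.sum_congr rfl h, Finset.sum_ite_eq]
  split_ifs with hd
  · rfl
  · have hlt : q.totalDegree < d := by
      rw [mem_range, not_lt] at hd
      omega
    rw [homogeneousComponent_eq_zero _ _ hlt, map_zero]

/-! ### Prop. 2.7 for a linear matrix, then the named fact -/

/-- **Yabe Prop. 2.7, matrix form.** For an `n × n` matrix `A` of LINEAR forms, `α ∈ K` and `k ≥ 1`, the
degree-`2k` part of `α · det(A + 1)` is a sum of `n²` products of two forms of degree `k` (the width-`n²`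
Mahajan–Vinay program for the coefficient of `λ^{n−2k}`, split at layer `k`), hence has bi-polynomial
rank `≤ n²`. [cite: Yabe2015, Proposition 2.7 (proof); Theorem 2.11; Fact 2.10] -/
theorem bRank_homogeneousComponent_det_add_one_le_sq {σ : Type v}
    (A : Matrix (Fin n) (Fin n) (MvPolynomial σ K)) (hA : ∀ i j, (A i j).IsHomogeneous 1) (α : K)
    (k : ℕ) (hk : 1 ≤ k) :
    bRank k (homogeneousComponent (2 * k) (C α * (A + 1).det)) ≤ n ^ 2 := by
  classical
  obtain ⟨k, rfl⟩ : ∃ j, k = j + 1 := ⟨k - 1, by omega⟩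
  -- the substitution `X_{ij} ↦ A_{ij}`
  set g : Fin n × Fin n → MvPolynomial σ K := fun ij => A ij.1 ij.2 with hg
  have hg1 : ∀ ij, (g ij).IsHomogeneous 1 := fun ij => hA ij.1 ij.2
  set φ : MvPolynomial (Fin n × Fin n) K →ₐ[K] MvPolynomial σ K := aeval g with hφ
  have hA' : (φ : MvPolynomial (Fin n × Fin n) K →+* MvPolynomial σ K).mapMatrix
      (1 + mvPolynomialX (Fin n) (Fin n) K) = A + 1 := by
    rw [map_add, map_one, add_comm]
    congr 1
    ext i j
    simp [hφ, hg, mvPolynomialX_apply]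
  have hdet : (A + 1).det = φ (1 + mvPolynomialX (Fin n) (Fin n) K).det := by
    rw [← hA', ← RingHom.map_det]; rfl
  -- the degree-`2(k+1)` part is `α · φ (e n (2(k+1)))`, a sum of `n²` products
  have hcomp : homogeneousComponent (2 * (k + 1)) (C α * (A + 1).det) =
      ∑ σ' : Fin n × Fin n, (C α * φ (sv K n (k + 1) σ'.1 σ'.2)) *
        φ (∑ t : Fin n, (T₀ K n ^ (k + 1)) σ' (t, t)) := by
    rw [homogeneousComponent_C_mul, hdet, hφ, homogeneousComponent_aeval_of_isHomogeneous_one g hg1,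
      homogeneousComponent_det_one_add_mvPolynomialX, pow_mul, neg_one_sq, one_pow, one_mul,
      e_self_two_mul_succ_eq_sum, map_sum, Finset.mul_sum]
    refine Finset.sum_congr rfl fun σ' _ => ?_
    rw [map_mul, mul_assoc]
  have hcard : Fintype.card (Fin n × Fin n) = n ^ 2 := by
    rw [Fintype.card_prod, Fintype.card_fin, sq]
  rw [← hcard]
  refine bRank_le_of_eq_sum (fun σ' => C α * φ (sv K n (k + 1) σ'.1 σ'.2))
    (fun σ' => φ (∑ t : Fin n, (T₀ K n ^ (k + 1)) σ' (t, t))) (fun σ' => ?_) (fun σ' => ?_) hcomp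
  · have h := (isHomogeneous_sv (K := K) (n := n) (k + 1) σ'.1 σ'.2).aeval g hg1
    rw [one_mul] at h
    exact h.C_mul α
  · have h := (isHomogeneous_sum_T₀_pow_diag (K := K) k σ').aeval g hg1
    rwa [one_mul] at h

end YabeABP

/-- **Yabe 2015, Prop. 2.7 — PROVED**: over a field `K`, for `p ∈ K[x_σ]` (`σ` finite), `k ≥ 1` and a
NON-zero `x₀` of `p`, `brank((p_{x₀})^{(2k)}) ≤ dc(p)²` ("`dc(p) ≥ √(brank(p_{x₀}^{(2k)}))`", p0006:L62):
Lemma 2.8 (`yabe2015_lemma_2_8_holds`) and the width-`n²` split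
`YabeABP.bRank_homogeneousComponent_det_add_one_le_sq`. Discharges `yabe2015_prop_2_7`.
[cite: Yabe2015, Proposition 2.7] -/
theorem yabe2015_prop_2_7_holds : yabe2015_prop_2_7.{u, v} := by
  intro K _ σ _ _ p k x₀ hk hx
  obtain ⟨A, α, hA, hp⟩ := yabe2015_lemma_2_8_holds K σ p (determinantalComplexity p) x₀ rfl hx
  rw [hp]
  exact YabeABP.bRank_homogeneousComponent_det_add_one_le_sq A hA α k hk

end Literature.Computability.AlgebraicComplexity

end
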